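import Summits.Ventures.HodgeRepro2.A2PontryaginLefschetz
import Summits.Ventures.HodgeRepro2.A2HardLefschetzMain

/-!
# `Λ^m L^m` on primitive classes, and Theorem A's class of `L^{n−k} v` (A2 annex, operator identity — part 10)

The sl₂-computation behind the constants: for a PRIMITIVE class `v ∈ ⋀^k` (`Λ v = 0`) the flat
Kähler identity of row 102 (`lam_lef_pow`) gives

  `Λ^m L^m v = ∏_{j<m} (j+1)(n−k−j) • v`   (`lam_pow_lef_pow_primitive`),

and for `m = n − k` the constant is `((n−k)!)²` (`lefConst_card_sub`).  With the operator identity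
of row 109, Theorem A's class of `z = L^{n−k} v` is therefore `z ⋆ θ^k = κ • v` with
`κ = (n−k)!·k!·(∏ c_p)·vol` (`pontryagin_lef_pow_primitive`): the class identity
`z ⋆ θ^k = κ • (L^{n−k})⁻¹ z` holds EXACTLY when the Lieberman class `(L^{n−k})⁻¹ z` is primitive
(`pontryagin_eq_smul_lefschetzInv_of_primitive`) — the positive counterpart of the witness of
`A2LiebermanClassWitness`, and the reason row 104's constant is `κ = κ'·((n−k)!)²`.
-/

namespace Summit.Ventures.HodgeRepro2.A2PrimitiveLefschetz

open WeilPlanes WeilIntegral WeilCoproduct A2HardLefschetzOps A2HardLefschetzMain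
  A2PontryaginModel A2PontryaginLefschetz

variable {ι : Type*} [DecidableEq ι] [Fintype ι]

/-- The constant `∏_{j<m} (j+1)(n−k−j)` of the sl₂-computation. -/
noncomputable def lefConst (n k m : ℕ) : ℂ :=
  ∏ j ∈ Finset.range m, (((j : ℂ) + 1) * ((n : ℂ) - k - j))

/-- `lefConst n k 0 = 1`. -/
@[simp] lemma lefConst_zero (n k : ℕ) : lefConst n k 0 = 1 := by
  simp [lefConst]

/-- The recursion `lefConst n k (m+1) = lefConst n k m · (m+1)(n−k−m)`. -/
lemma lefConst_succ (n k m : ℕ) :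
    lefConst n k (m + 1) = lefConst n k m * (((m : ℂ) + 1) * ((n : ℂ) - k - m)) := by
  simp [lefConst, Finset.prod_range_succ]

/-- `L^m y = θ^m ∧ y`. -/
lemma lef_pow_apply (c : ι → ℂ) (m : ℕ) (y : A ι) : (lef c ^ m) y = theta c ^ m * y := by
  induction m with
  | zero => simp
  | succ m ih => rw [pow_succ', Module.End.mul_apply, ih, lef, LinearMap.mulLeft_apply, pow_succ',
      mul_assoc]

/-- **`Λ^m L^m` on a primitive class** `v ∈ ⋀^k`: `Λ^m L^m v = ∏_{j<m} (j+1)(n−k−j) • v`. -/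
theorem lam_pow_lef_pow_primitive {c : ι → ℂ} (hc : ∀ p, c p ≠ 0) {k : ℕ} {v : A ι}
    (hv : v ∈ grading ι k) (hprim : lam c v = 0) (m : ℕ) :
    (lam c ^ m) ((lef c ^ m) v) = lefConst (Fintype.card ι) k m • v := by
  induction m with
  | zero => simp
  | succ m ih =>
    rw [pow_succ (lam c), Module.End.mul_apply, lam_lef_pow hc hv m, hprim, map_zero, zero_add,
      map_smul, ih, smul_smul, lefConst_succ, mul_comm]

/-- `∏_{j<m} (j+1) = m!` in `ℂ`. -/
lemma prod_range_add_one_eq (m : ℕ) :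
    ∏ j ∈ Finset.range m, ((j : ℂ) + 1) = (m.factorial : ℂ) := by
  rw [← Finset.prod_range_add_one_eq_factorial]
  push_cast
  rfl

/-- `∏_{j<m} (m − j) = m!` in `ℂ`. -/
lemma prod_range_sub_eq (m : ℕ) :
    ∏ j ∈ Finset.range m, ((m : ℂ) - j) = (m.factorial : ℂ) := by
  rw [← prod_range_add_one_eq m, ← Finset.prod_range_reflect (fun j => ((j : ℂ) + 1)) m]
  refine Finset.prod_congr rfl fun j hj => ?_
  have hjm : j < m := Finset.mem_range.1 hj
  have : ((m - 1 - j : ℕ) : ℂ) = (m : ℂ) - 1 - j := by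
    rw [Nat.cast_sub (by omega), Nat.cast_sub (by omega)]
    push_cast
    ring
  rw [this]
  ring

/-- **The constant for `m = n − k` is `((n−k)!)²`.** -/
theorem lefConst_card_sub (n k : ℕ) (hk : k ≤ n) :
    lefConst n k (n - k) = ((n - k).factorial : ℂ) ^ 2 := by
  rw [lefConst, Finset.prod_mul_distrib, prod_range_add_one_eq, pow_two]
  congr 1
  rw [← prod_range_sub_eq (n - k)]
  refine Finset.prod_congr rfl fun j _ => ?_
  rw [Nat.cast_sub hk]

/-- **Theorem A's class of `z = L^{n−k} v`, `v` primitive of degree `k`**: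
`z ⋆ θ^k = (n−k)!·k!·(∏ c_p)·vol • v` — the class itself, not only its Weil projection. -/
theorem pontryagin_lef_pow_primitive {c : ι → ℂ} (hc : ∀ p, c p ≠ 0) {k : ℕ}
    (hk : k ≤ Fintype.card ι) {v : A ι} (hv : v ∈ grading ι k) (hprim : lam c v = 0) :
    pontryagin (theta c ^ (Fintype.card ι - k) * v) (theta c ^ k) =
      ((((Fintype.card ι - k).factorial : ℂ) * (k.factorial : ℂ) * ∏ p, c p) * vol ι) • v := by
  rw [pontryagin_theta_pow_eq_smul_lam_pow hc hk, ← lef_pow_apply, lam_pow_lef_pow_primitive hc hv hprim,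
    lefConst_card_sub _ _ hk, smul_smul, kappa']
  congr 1
  have hfac : ((Fintype.card ι - k).factorial : ℂ) ≠ 0 := by
    exact_mod_cast Nat.factorial_ne_zero _
  field_simp

/-- **The class identity of (A9) holds exactly in the primitive case**: if the Lieberman class
`y'' = (L^{n−k})⁻¹ z` is primitive, then `z ⋆ θ^k = (n−k)!·k!·(∏ c_p)·vol • y''` as classes. -/
theorem pontryagin_eq_smul_lefschetzInv_of_primitive {c : ι → ℂ} (hc : ∀ p, c p ≠ 0) {k : ℕ}
    (hk : k ≤ Fintype.card ι) {z : A ι} (hz : z ∈ grading ι (2 * Fintype.card ι - k))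
    (hprim : lam c (lefschetzInv c hc hk hz) = 0) :
    pontryagin z (theta c ^ k) =
      ((((Fintype.card ι - k).factorial : ℂ) * (k.factorial : ℂ) * ∏ p, c p) * vol ι) •
        lefschetzInv c hc hk hz := by
  have h := pontryagin_lef_pow_primitive hc hk (lefschetzInv_mem c hc hk hz) hprim
  rwa [theta_pow_mul_lefschetzInv c hc hk hz] at h

end Summit.Ventures.HodgeRepro2.A2PrimitiveLefschetz
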